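import Literature.MathematicalPhysics.QuantumFieldTheory.Balaban1983to89.B6ScalarAgreeV1Chart
import HarnessLib

/-!
# [B6] Prop. 2.6, line 3 of (2.92): the GLUED block distance of the window `T_□ = □̃³ ⊂ T_η` — one pseudo-distance on the global
blocks `𝔅` below BOTH the global multiscale distance (2.46) of `T_η` and the member's distance of `T_□` read through the chart, so that the
global factors `G′, S, ∂G′, G′∂*` AND the transplanted member factors `εG′_□ρ, εS_□ρ` have (2.67)/(2.87)-shape majorants for ALL block pairs
with respect to the SAME distance (the data format of p38's `B6DomainChangeP2134Sizes.line3P_hasMajorant`, generic in `g.dist`)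

statement-level skeleton of published theorems with citation tags; proofs where landed; nothing here is a claim about the Yang–Mills mass gap

[tag: formalized_from_source] (construction ours; the identification *"We take the cube □̃³ and identify it with a torus, denoted by T_□,
imposing periodicity conditions"* and the operators on it are [cite: Balaban1984PropagatorsII, p.238–239]; the distance is (2.46) p.231;
the use is the change-of-domain estimate of p.238 («an estimate has the factor e^{−δ₀M}») for (2.92) line 3, p.239.)

## Why

The member torus `T_□` is the full window `[x₀, x₀ + 2L^e)^{d+1} ⊂ T_η` with PERIODIC identification (r03's bijective site chart
`B6AgreeLapV1Chart.cS`).  The sandwich ring data of line 3 (`B6ScalarAgreeV1Chart.hS2_window`, `transplant_GSG`) need this bijectivity,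
but then `εG′_□ρ` has WRAP-AROUND pairs: sites near opposite faces of the window are neighbours of `T_□` (kernel of size `B₁w²`, no decay)
while their global distance is the window length — no majorant `B₁w²e^{−δ d_T(y,y′)}` with the GLOBAL `d_T` holds uniformly.  p38's
size theorem is generic in the pseudo-distance; this file supplies the one that works:

* §1 generic graph lemmas: distances in a supergraph `G ⊔ H`; the first / last `H`-edge of a geodesic;
* §2 the block transport `ψ : 𝔅(T_□) → 𝔅(T_η)` of the window (well defined, injective, level preserving — from the block correspondence
  `B6ScalarAgreeV1Chart.blkOf_eS_eq_iff`);
* §3 **the glued bond graph** `bondT D ⊔ ψ(bondT D₁)` on `𝔅(T_η)`, its graph distance `d′` and the geometry `geomW` (= p21's `geomTB D` with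
  `dist := d′`): realised (so (2.54), `d′(y,y) = 0`, `d′ ≥ 0`, symmetry: `IsPseudoDist`), `d′ ≤ d_T`, `d′(ψb, ψb′) ≤ d_{T_□}(b, b′)`;
* §4 the foreign (wrap) edges join FACE blocks of the window only (`foreign_face`); hence `d′ = d_T` on pairs closer to each other than to
  the faces (`dist_eq_of_far_faces`) — the located pairs of (2.134);
* §5 the level separation `R·M·(|j − j′| − (2 + spread)) ≤ d′` (from p21's `levelSepTB` on the global segments of a glued geodesic; `spread`
  = the member's level spread, `1` for the two-level members), i.e. the (2.60)-type TRANSFER `e^{−κd′}·L^{j′} ≤ L^{2+spread}·L^{j}` for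
  `κ·R·M ≥ log L`, and the (2.61)-type PROFILE `Σ_b e^{−a d′(y,b)} ≤ K(a)·(1 + #𝔅(T_□))` from the global profile;
* §6 **TRANSPORT OF MEMBER MAJORANTS**: a majorant `φ(j(b))·e^{−δ d_{T_□}(b,b′)}` of `T′` on `T_□` (w.r.t. the member's blocks) gives the
  majorant `φ(j(y))·e^{−δ d′(y,y′)}` of `εT′ρ` on `T_η` for ALL pairs (r03's `localMajorant_transplant` with the exact block correspondence:
  every global block meeting the window is one member block); global majorants pass from `d_T` to `d′` by monotonicity.

Hypotheses relating the families are those of `B6ScalarAgreeV1Chart`: `hlevW` (levels agree through the chart on the window), `hal`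
(`L^{k₁} ∣ x₀`), `hk₁ : k₁ ≤ m_□ + K_□`.  No measure, no Yang–Mills claim.
-/

open scoped BigOperators
open Finset

namespace Literature.MathematicalPhysics.QuantumFieldTheory.Balaban1983to89.B6GluedDistWindow

open B4Reflection242 (boxDom mem_boxDom blk)
open B4TorusKernel.MultiPeriod (torusSupNorm circAbs torusSupNorm_le_supNorm)
open B4ContourShift (supNorm)
open B6MultiLevelBoxOperator (N0)
open B6MultiLevelTorusOperator (TDomains one_le_of_mem)
open B6Geom246MultiLevelBox (bset blkOf blkOf_val exists_blkOf_eq)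
open B6Geom246MultiLevelTorus (TouchT bondT bondT_adj connectedT geomT)
open B8Ineq192MultiLevelTorus (geomTB geomTB_len geomTB_M geomTB_RM levelSepTB)
open B6Geometry (ContourSystem Realizes dist_self_of_realizes dist_nonneg_of_realizes dist_comm_of_realizes triangle254_of_realizes)
open B6Ineq268 (LevelSep mx)
open B4Sect5Torus (IsPseudoDist)
open B6DomainChange (Profile)
open B6RandomWalk (HasMajorant BlockSupp hasMajorant_mono)
open B6Prop26Gluing (LocalMajorant)
open B6Prop26ReachTransplant (restrictOp extendOp transplant transplant_apply localMajorant_transplant sitesPerDir_zero)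
open B6GlobalChartV1 (PV toBox toBox_apply toBox_injective toBox_surjective boxEquiv)
open B6ScalarFactorsChartV1 (blkS)
open B6Prop25TwoScaleCensus (TSIdx)
open B6AgreeLapV1Chart (WChart eS DeepS deepS_mono val_eS eS_surj cS mem_cS_W cS_e)
open B6ScalarAgreeV1Chart (exists_window_preimage blkOf_eS_eq_iff mem_deepS_of_blkOf_eq toBox_eS_eq)

/-! ## §1  Distances in a supergraph; the first and the last foreign edge of a geodesic -/

section Graph

variable {V : Type*} {G H : SimpleGraph V}

/-- a walk of `G ⊔ H` either has all its edges in `G`, or splits at its FIRST edge not in `G` (an `H`-edge) after an initial `G`-walk.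
[cite: Balaban1984PropagatorsII, (2.46) p.231 («inf over admissible contours»), dictionary] -/
theorem walk_sup_split {u v : V} (p : (G ⊔ H).Walk u v) :
    (∃ q : G.Walk u v, q.length ≤ p.length) ∨
      ∃ a b : V, H.Adj a b ∧ ¬ G.Adj a b ∧ ∃ q : G.Walk u a, ∃ r : (G ⊔ H).Walk b v, q.length + 1 + r.length ≤ p.length := by
  induction p with
  | nil => exact Or.inl ⟨SimpleGraph.Walk.nil, le_rfl⟩
  | @cons u w v h p ih =>
    by_cases hG : G.Adj u w
    · rcases ih with ⟨q, hq⟩ | ⟨a, b, hab, hnab, q, r, hqr⟩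
      · refine Or.inl ⟨SimpleGraph.Walk.cons hG q, ?_⟩
        rw [SimpleGraph.Walk.length_cons, SimpleGraph.Walk.length_cons]
        omega
      · refine Or.inr ⟨a, b, hab, hnab, SimpleGraph.Walk.cons hG q, r, ?_⟩
        rw [SimpleGraph.Walk.length_cons, SimpleGraph.Walk.length_cons]
        omega
    · have hH : H.Adj u w := ((SimpleGraph.sup_adj _ _ _ _).1 h).resolve_left hG
      refine Or.inr ⟨u, w, hH, hG, SimpleGraph.Walk.nil, p, ?_⟩
      rw [SimpleGraph.Walk.length_nil, SimpleGraph.Walk.length_cons]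
      omega

/-- distances do not increase in a supergraph. [cite: Balaban1984PropagatorsII, (2.46) p.231, dictionary] -/
theorem dist_sup_le (hG : G.Connected) (u v : V) : (G ⊔ H).dist u v ≤ G.dist u v := by
  obtain ⟨p, hp⟩ := hG.exists_walk_length_eq_dist u v
  calc (G ⊔ H).dist u v ≤ (p.mapLe (le_sup_left : G ≤ G ⊔ H)).length := SimpleGraph.dist_le _
    _ = p.length := SimpleGraph.Walk.length_map _ _
    _ = G.dist u v := hp

/-- **FIRST FOREIGN EDGE**: either the `G ⊔ H`-distance is the `G`-distance, or a geodesic runs in `G` from `u` to the tail `a` of an `H`-edge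
`(a, b)` that is not a `G`-edge and continues from `b`: `d_G(u,a) + 1 + d′(b,v) ≤ d′(u,v)`. [cite: Balaban1984PropagatorsII, (2.46) p.231, dictionary] -/
theorem dist_sup_cases (hG : G.Connected) (u v : V) :
    G.dist u v = (G ⊔ H).dist u v ∨
      ∃ a b : V, H.Adj a b ∧ ¬ G.Adj a b ∧ G.dist u a + 1 + (G ⊔ H).dist b v ≤ (G ⊔ H).dist u v := by
  have hGH : (G ⊔ H).Connected := hG.mono le_sup_left
  obtain ⟨p, hp⟩ := hGH.exists_walk_length_eq_dist u v
  rcases walk_sup_split p with ⟨q, hq⟩ | ⟨a, b, hab, hnab, q, r, hqr⟩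
  · left
    refine le_antisymm ?_ (dist_sup_le hG u v)
    calc G.dist u v ≤ q.length := SimpleGraph.dist_le q
      _ ≤ p.length := hq
      _ = _ := hp
  · right
    refine ⟨a, b, hab, hnab, ?_⟩
    calc G.dist u a + 1 + (G ⊔ H).dist b v ≤ q.length + 1 + r.length :=
          Nat.add_le_add (Nat.add_le_add_right (SimpleGraph.dist_le q) 1) (SimpleGraph.dist_le r)
      _ ≤ p.length := hqr
      _ = _ := hp

/-- **LAST FOREIGN EDGE** (the same read on the reversed geodesic): `d′(u,a) + 1 + d_G(b,v) ≤ d′(u,v)`. [cite: Balaban1984PropagatorsII, (2.46) p.231, dictionary] -/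
theorem dist_sup_cases' (hG : G.Connected) (u v : V) :
    G.dist u v = (G ⊔ H).dist u v ∨
      ∃ a b : V, H.Adj a b ∧ ¬ G.Adj a b ∧ (G ⊔ H).dist u a + 1 + G.dist b v ≤ (G ⊔ H).dist u v := by
  rcases dist_sup_cases (H := H) hG v u with h | ⟨a, b, hab, hnab, h⟩
  · left
    rwa [SimpleGraph.dist_comm, SimpleGraph.dist_comm (G := G ⊔ H)] at h
  · right
    refine ⟨b, a, hab.symm, fun h' => hnab h'.symm, ?_⟩
    rw [SimpleGraph.dist_comm (G := G) (u := v), SimpleGraph.dist_comm (G := G ⊔ H) (u := b),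
      SimpleGraph.dist_comm (G := G ⊔ H) (u := v)] at h
    omega

end Graph

/-! ## §2  The block transport `ψ : 𝔅(T_□) → 𝔅(T_η)` of the window -/

section Psi

variable {d ℓ : ℕ} {m K : ℕ} {hd : 1 ≤ d + 1} {hL : Odd (ℓ + 1) ∧ 1 < ℓ + 1} {Mh k R : ℕ} {P' : Fin (d + 1) → ℕ}
variable (hN : ∀ μ, N0 ℓ Mh k P' μ = (PV d ℓ m K hd hL).sitesPerDir 0) (D : TDomains d ℓ Mh k P' R)
variable {a₀ a₁ : ℝ} {t : TSIdx d (ℓ + 1) hd hL a₀ a₁} {x₀ : Fin (d + 1) → ℤ}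
variable (hx₀ : ∀ μ, 0 ≤ x₀ μ) (hfit : ∀ μ, x₀ μ + (t.P.sitesPerDir 0 : ℕ) ≤ ((PV d ℓ m K hd hL).sitesPerDir 0 : ℕ))
variable {Mh₁ k₁ R₁ : ℕ} {P₁ : Fin (d + 1) → ℕ}
variable (hN₁ : ∀ μ, N0 ℓ Mh₁ k₁ P₁ μ = (PV d ℓ t.m t.K hd hL).sitesPerDir 0) (D₁ : TDomains d ℓ Mh₁ k₁ P₁ R₁)

/-- a window site charted into (any chosen site of) the member block `b`. [cite: Balaban1984PropagatorsII, p.238 (T_□ = □̃³), dictionary] -/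
noncomputable def wsite (b : ↥(bset D₁.toDomains)) : Site (PV d ℓ m K hd hL) 0 :=
  Classical.choose (exists_window_preimage hN₁ hx₀ hfit (Classical.choose (exists_blkOf_eq D₁.toDomains b)))

/-- the chosen site lies in the window and is charted into the block. [cite: Balaban1984PropagatorsII, p.238 (T_□ = □̃³), dictionary] -/
theorem wsite_spec (b : ↥(bset D₁.toDomains)) :
    wsite hx₀ hfit hN₁ D₁ b ∈ DeepS t x₀ 0 ∧ blkOf D₁.toDomains (toBox hN₁ (eS t x₀ (wsite hx₀ hfit hN₁ D₁ b))) = b := by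
  obtain ⟨hx, he⟩ := Classical.choose_spec (exists_window_preimage (m := m) (K := K) hN₁ hx₀ hfit
    (Classical.choose (exists_blkOf_eq D₁.toDomains b)))
  refine ⟨hx, ?_⟩
  have hb := Classical.choose_spec (exists_blkOf_eq D₁.toDomains b)
  unfold wsite
  rw [he, hb]

/-- **THE BLOCK TRANSPORT** `ψ`: the global block of (the window sites charted into) a member block — our gloss «inside the window the
member's levels are the global ones» of p. 239 (2.89) *"B^j(Λ) = □̃² ∩ B^{j+1}(Λ_{j+1})"*, read on the blocks.
[cite: Balaban1984PropagatorsII, (2.89) p.239, p.238 (T_□ = □̃³), dictionary] -/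
noncomputable def ψblk (b : ↥(bset D₁.toDomains)) : ↥(bset D.toDomains) :=
  blkOf D.toDomains (toBox hN (wsite hx₀ hfit hN₁ D₁ b))

/-- `ψ` evaluated: the member block of a window site goes to its global block. [cite: Balaban1984PropagatorsII, (2.89) p.239, dictionary] -/
theorem ψblk_blkOf (hlevW : ∀ x ∈ DeepS t x₀ 0, D₁.lev (toBox hN₁ (eS t x₀ x) : Fin (d + 1) → ℤ) = D.lev (toBox hN x))
    (hal : ∀ μ, (((ℓ + 1) ^ k₁ : ℕ) : ℤ) ∣ x₀ μ) {x : Site (PV d ℓ m K hd hL) 0} (hx : x ∈ DeepS t x₀ 0) :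
    ψblk hN D hx₀ hfit hN₁ D₁ (blkOf D₁.toDomains (toBox hN₁ (eS t x₀ x))) = blkOf D.toDomains (toBox hN x) := by
  obtain ⟨hw, hb⟩ := wsite_spec hx₀ hfit hN₁ D₁ (blkOf D₁.toDomains (toBox hN₁ (eS t x₀ x)))
  exact (blkOf_eS_eq_iff hN D hN₁ D₁ hlevW hal hw hx).1 hb

/-- `ψ` is injective. [cite: Balaban1984PropagatorsII, (2.89) p.239, dictionary] -/
theorem ψblk_injective (hlevW : ∀ x ∈ DeepS t x₀ 0, D₁.lev (toBox hN₁ (eS t x₀ x) : Fin (d + 1) → ℤ) = D.lev (toBox hN x))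
    (hal : ∀ μ, (((ℓ + 1) ^ k₁ : ℕ) : ℤ) ∣ x₀ μ) : Function.Injective (ψblk hN D hx₀ hfit hN₁ D₁) := by
  intro b b' h
  obtain ⟨hw, hb⟩ := wsite_spec hx₀ hfit hN₁ D₁ b
  obtain ⟨hw', hb'⟩ := wsite_spec hx₀ hfit hN₁ D₁ b'
  rw [← hb, ← hb']
  exact (blkOf_eS_eq_iff hN D hN₁ D₁ hlevW hal hw hw').2 h

/-- `ψ` preserves the level. [cite: Balaban1984PropagatorsII, (2.89) p.239, dictionary] -/
theorem ψblk_level (hlevW : ∀ x ∈ DeepS t x₀ 0, D₁.lev (toBox hN₁ (eS t x₀ x) : Fin (d + 1) → ℤ) = D.lev (toBox hN x))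
    (b : ↥(bset D₁.toDomains)) : (ψblk hN D hx₀ hfit hN₁ D₁ b).1.1 = b.1.1 := by
  obtain ⟨hw, hb⟩ := wsite_spec hx₀ hfit hN₁ D₁ b
  have h2 := congrArg (fun s : ↥(bset D₁.toDomains) => s.1.1) hb
  rw [← h2]
  exact (hlevW _ hw).symm

/-- the image of `ψ` consists of window blocks. [cite: Balaban1984PropagatorsII, p.238 (T_□ = □̃³), dictionary] -/
theorem ψblk_window (b : ↥(bset D₁.toDomains)) :
    ∃ x ∈ DeepS (m := m) (K := K) t x₀ 0, ψblk hN D hx₀ hfit hN₁ D₁ b = blkOf D.toDomains (toBox hN x) :=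
  ⟨wsite hx₀ hfit hN₁ D₁ b, (wsite_spec hx₀ hfit hN₁ D₁ b).1, rfl⟩

end Psi

/-! ## §3  The glued bond graph, its distance `d′` and the geometry `geomW` -/

section Glued

variable {d ℓ : ℕ} {m K : ℕ} {hd : 1 ≤ d + 1} {hL : Odd (ℓ + 1) ∧ 1 < ℓ + 1} {Mh k R : ℕ} {P' : Fin (d + 1) → ℕ}
variable (hN : ∀ μ, N0 ℓ Mh k P' μ = (PV d ℓ m K hd hL).sitesPerDir 0) (D : TDomains d ℓ Mh k P' R)
variable {a₀ a₁ : ℝ} {t : TSIdx d (ℓ + 1) hd hL a₀ a₁} {x₀ : Fin (d + 1) → ℤ}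
variable (hx₀ : ∀ μ, 0 ≤ x₀ μ) (hfit : ∀ μ, x₀ μ + (t.P.sitesPerDir 0 : ℕ) ≤ ((PV d ℓ m K hd hL).sitesPerDir 0 : ℕ))
variable {Mh₁ k₁ R₁ : ℕ} {P₁ : Fin (d + 1) → ℕ}
variable (hN₁ : ∀ μ, N0 ℓ Mh₁ k₁ P₁ μ = (PV d ℓ t.m t.K hd hL).sitesPerDir 0) (D₁ : TDomains d ℓ Mh₁ k₁ P₁ R₁)

/-- the member's admissible bonds read on the global blocks through `ψ`. [cite: Balaban1984PropagatorsII, (2.46) p.231, p.238 (T_□), dictionary] -/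
def memRel (a b : ↥(bset D.toDomains)) : Prop :=
  ∃ b₁ b₁' : ↥(bset D₁.toDomains), (bondT D₁).Adj b₁ b₁' ∧ ψblk hN D hx₀ hfit hN₁ D₁ b₁ = a ∧ ψblk hN D hx₀ hfit hN₁ D₁ b₁' = b

/-- **THE GLUED BOND GRAPH**: the admissible bonds of `T_η` together with the admissible bonds of `T_□` transported by `ψ` (the latter include
the WRAP-AROUND bonds of the periodic window). [cite: Balaban1984PropagatorsII, (2.46) p.231, p.238 (T_□ «with periodicity conditions»), dictionary] -/
def gluedBond : SimpleGraph ↥(bset D.toDomains) := bondT D ⊔ SimpleGraph.fromRel (memRel hN D hx₀ hfit hN₁ D₁)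

/-- **THE GLUED GEOMETRY** `geomW`: p21's `geomTB D` (sites `𝔅`, scale, `L`, `M = L·M_h`, `R`) with the distance replaced by the graph distance
`d′` of the glued bond graph. [cite: Balaban1984PropagatorsII, (2.45)–(2.46) p.231, p.238–239 (T_□); construction ours] -/
noncomputable def geomW : B6.Geometry :=
  { geomTB D with dist := fun a b => (((gluedBond hN D hx₀ hfit hN₁ D₁).dist a b : ℕ) : ℝ) }

/-- the contour system realising `geomW`. [cite: Balaban1984PropagatorsII, (2.46) p.231, dictionary] -/
def csysW : ContourSystem (geomW hN D hx₀ hfit hN₁ D₁) :=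
  ⟨↥(bset D.toDomains), gluedBond hN D hx₀ hfit hN₁ D₁, id, fun s => s.1.1, fun _ => rfl⟩

/-- `geomW` is realised by `csysW`. [cite: Balaban1984PropagatorsII, (2.46) p.231, dictionary] -/
theorem realizesW : Realizes (geomW hN D hx₀ hfit hN₁ D₁) (csysW hN D hx₀ hfit hN₁ D₁) := fun _ _ => rfl

/-- the sites, scale, lengths and `M` of `geomW` are those of `geomTB D`. [cite: Balaban1984PropagatorsII, (2.45) p.231, dictionary] -/
theorem geomW_len (y : ↥(bset D.toDomains)) : (geomW hN D hx₀ hfit hN₁ D₁).len y = (geomTB D).len y := rfl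

/-- `M` of `geomW` is `L·M_h`. [cite: Balaban1984PropagatorsII, (2.2) p.224, dictionary] -/
theorem geomW_M : (geomW hN D hx₀ hfit hN₁ D₁).M = (geomTB D).M := rfl

/-- the distance of `geomW` is the glued graph distance. [cite: Balaban1984PropagatorsII, (2.46) p.231, dictionary] -/
theorem geomW_dist (a b : ↥(bset D.toDomains)) :
    (geomW hN D hx₀ hfit hN₁ D₁).dist a b = (((gluedBond hN D hx₀ hfit hN₁ D₁).dist a b : ℕ) : ℝ) := rfl

/-- the glued bond graph is connected. [cite: Balaban1984PropagatorsII, (2.46) p.231, dictionary] -/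
theorem connectedW (hMh : 1 ≤ Mh) (hP : ∀ μ, 1 ≤ P' μ) : (gluedBond hN D hx₀ hfit hN₁ D₁).Connected :=
  (connectedT (D := D) hMh hP).mono le_sup_left

/-- **`d′` IS A PSEUDO-DISTANCE** (symmetric, `d′(y,y) = 0`, (2.54)) — p38's `IsPseudoDist`. [cite: Balaban1984PropagatorsII, (2.54) p.233, (2.46) p.231] -/
theorem isPseudoDist_W (hMh : 1 ≤ Mh) (hP : ∀ μ, 1 ≤ P' μ) : IsPseudoDist (geomW hN D hx₀ hfit hN₁ D₁).dist :=
  ⟨dist_comm_of_realizes (realizesW hN D hx₀ hfit hN₁ D₁), dist_self_of_realizes (realizesW hN D hx₀ hfit hN₁ D₁),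
    fun a b c => triangle254_of_realizes (realizesW hN D hx₀ hfit hN₁ D₁) (connectedW hN D hx₀ hfit hN₁ D₁ hMh hP) a b c⟩

/-- `d′ ≥ 0`. [cite: Balaban1984PropagatorsII, (2.46) p.231] -/
theorem distW_nonneg (a b : ↥(bset D.toDomains)) : 0 ≤ (geomW hN D hx₀ hfit hN₁ D₁).dist a b :=
  dist_nonneg_of_realizes (realizesW hN D hx₀ hfit hN₁ D₁) a b

/-- **`d′ ≤ d_T`**: the glued distance is below the global multiscale distance (so every global majorant `…e^{−δd_T}` is a majorant `…e^{−δd′}`).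
[cite: Balaban1984PropagatorsII, (2.46) p.231, dictionary] -/
theorem distW_le_distT (hMh : 1 ≤ Mh) (hP : ∀ μ, 1 ≤ P' μ) (a b : ↥(bset D.toDomains)) :
    (geomW hN D hx₀ hfit hN₁ D₁).dist a b ≤ (geomTB D).dist a b := by
  rw [geomW_dist]
  show (((bondT D ⊔ _).dist a b : ℕ) : ℝ) ≤ (((bondT D).dist a b : ℕ) : ℝ)
  exact_mod_cast dist_sup_le (connectedT (D := D) hMh hP) a b

/-- `ψ` is a homomorphism of the member's bond graph into the glued graph. [cite: Balaban1984PropagatorsII, (2.46) p.231, p.238 (T_□), dictionary] -/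
noncomputable def ψhom (hlevW : ∀ x ∈ DeepS t x₀ 0, D₁.lev (toBox hN₁ (eS t x₀ x) : Fin (d + 1) → ℤ) = D.lev (toBox hN x))
    (hal : ∀ μ, (((ℓ + 1) ^ k₁ : ℕ) : ℤ) ∣ x₀ μ) : bondT D₁ →g gluedBond hN D hx₀ hfit hN₁ D₁ where
  toFun := ψblk hN D hx₀ hfit hN₁ D₁
  map_rel' := fun {b b'} h => by
    refine (SimpleGraph.sup_adj _ _ _ _).2 (Or.inr ((SimpleGraph.fromRel_adj _ _ _).2 ⟨?_, Or.inl ⟨b, b', h, rfl, rfl⟩⟩))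
    exact fun he => h.ne (ψblk_injective hN D hx₀ hfit hN₁ D₁ hlevW hal he)

/-- **`d′(ψb, ψb′) ≤ d_{T_□}(b, b′)`**: member contours are glued contours (so every member majorant `…e^{−δd_{T_□}}` read through the chart is a
majorant `…e^{−δd′}`). [cite: Balaban1984PropagatorsII, (2.46) p.231, p.238–239 (T_□), dictionary] -/
theorem distW_ψ_le (hlevW : ∀ x ∈ DeepS t x₀ 0, D₁.lev (toBox hN₁ (eS t x₀ x) : Fin (d + 1) → ℤ) = D.lev (toBox hN x))
    (hal : ∀ μ, (((ℓ + 1) ^ k₁ : ℕ) : ℤ) ∣ x₀ μ) (hMh₁ : 1 ≤ Mh₁) (hP₁ : ∀ μ, 1 ≤ P₁ μ) (b b' : ↥(bset D₁.toDomains)) :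
    (geomW hN D hx₀ hfit hN₁ D₁).dist (ψblk hN D hx₀ hfit hN₁ D₁ b) (ψblk hN D hx₀ hfit hN₁ D₁ b') ≤ (geomTB D₁).dist b b' := by
  rw [geomW_dist]
  obtain ⟨p, hp⟩ := (connectedT (D := D₁) hMh₁ hP₁).exists_walk_length_eq_dist b b'
  have h := SimpleGraph.dist_le (p.map (ψhom hN D hx₀ hfit hN₁ D₁ hlevW hal))
  rw [SimpleGraph.Walk.length_map, hp] at h
  show ((_ : ℕ) : ℝ) ≤ (((bondT D₁).dist b b' : ℕ) : ℝ)
  exact_mod_cast h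

end Glued

/-! ## §4  Foreign edges join face blocks; `d′ = d_T` on pairs far from the faces -/

section Faces

variable {d ℓ : ℕ} {m K : ℕ} {hd : 1 ≤ d + 1} {hL : Odd (ℓ + 1) ∧ 1 < ℓ + 1} {Mh k R : ℕ} {P' : Fin (d + 1) → ℕ}
variable (hN : ∀ μ, N0 ℓ Mh k P' μ = (PV d ℓ m K hd hL).sitesPerDir 0) (D : TDomains d ℓ Mh k P' R)
variable {a₀ a₁ : ℝ} {t : TSIdx d (ℓ + 1) hd hL a₀ a₁} {x₀ : Fin (d + 1) → ℤ}
variable (hx₀ : ∀ μ, 0 ≤ x₀ μ) (hfit : ∀ μ, x₀ μ + (t.P.sitesPerDir 0 : ℕ) ≤ ((PV d ℓ m K hd hL).sitesPerDir 0 : ℕ))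
variable {Mh₁ k₁ R₁ : ℕ} {P₁ : Fin (d + 1) → ℕ}
variable (hN₁ : ∀ μ, N0 ℓ Mh₁ k₁ P₁ μ = (PV d ℓ t.m t.K hd hL).sitesPerDir 0) (D₁ : TDomains d ℓ Mh₁ k₁ P₁ R₁)

variable (t x₀) in
/-- **THE FACE BLOCKS** of the window: global blocks containing a window site with a label on a face (`x_μ = x₀_μ` or `x_μ = x₀_μ + 2L^e − 1`).
[cite: Balaban1984PropagatorsII, p.238 (□̃³ and its identification with T_□), dictionary] -/
def FaceBlk : Set ↥(bset D.toDomains) :=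
  {a | ∃ x ∈ DeepS (m := m) (K := K) t x₀ 0, blkOf D.toDomains (toBox hN x) = a ∧
    ∃ μ, ((x μ).val : ℤ) = x₀ μ ∨ ((x μ).val : ℤ) + 1 = x₀ μ + (t.P.sitesPerDir 0 : ℕ)}

omit hN D hx₀ hfit hN₁ D₁ in
/-- `circAbs N v ≤ 1` for `|v| < N` forces `|v| ≤ 1` or `|v| ≥ N − 1`. [folklore] -/
private theorem abs_cases_of_circAbs_le_one {N : ℕ} {v : ℤ} (hvN : |v| < N) (h : circAbs N v ≤ 1) :
    |v| ≤ 1 ∨ (N : ℤ) - 1 ≤ |v| := by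
  unfold circAbs at h
  rcases le_or_gt 0 v with hv | hv
  · have hvN' : v < N := by rwa [abs_of_nonneg hv] at hvN
    have hmod : v % (N : ℤ) = v := Int.emod_eq_of_lt hv hvN'
    rw [hmod] at h
    rw [abs_of_nonneg hv]
    rcases min_le_iff.1 h with h1 | h1
    · exact Or.inl h1
    · exact Or.inr (by omega)
  · have hmod : v % (N : ℤ) = v + N := by
      rw [abs_of_neg hv] at hvN
      have h1 : v + N = (v + N) % (N : ℤ) := (Int.emod_eq_of_lt (by omega) (by omega)).symm
      rw [h1, Int.add_emod_right]  -- (v + N) % N = v % N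
    rw [hmod] at h
    rw [abs_of_neg hv] at hvN ⊢
    rcases min_le_iff.1 h with h1 | h1
    · exact Or.inr (by omega)
    · exact Or.inl (by omega)

/-- **FOREIGN (WRAP) EDGES JOIN FACE BLOCKS**: a transported member bond that is not a global bond has both ends in `FaceBlk` (member neighbours
across the periodic identification sit on opposite faces of the window). [cite: Balaban1984PropagatorsII, p.238 (T_□ «imposing periodicity conditions»), (2.46) p.231; derivation ours] -/
theorem foreign_face (hlevW : ∀ x ∈ DeepS t x₀ 0, D₁.lev (toBox hN₁ (eS t x₀ x) : Fin (d + 1) → ℤ) = D.lev (toBox hN x))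
    (hal : ∀ μ, (((ℓ + 1) ^ k₁ : ℕ) : ℤ) ∣ x₀ μ) {a b : ↥(bset D.toDomains)}
    (hH : (SimpleGraph.fromRel (memRel hN D hx₀ hfit hN₁ D₁)).Adj a b) (hG : ¬ (bondT D).Adj a b) :
    a ∈ FaceBlk (m := m) (K := K) hN D t x₀ ∧ b ∈ FaceBlk (m := m) (K := K) hN D t x₀ := by
  -- unpack the member bond and pull it back to window sites
  obtain ⟨hne, hrel⟩ := (SimpleGraph.fromRel_adj _ _ _).1 hH
  -- w.l.o.g. the relation is oriented from `a` to `b` (both conclusions are symmetric)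
  suffices key : ∀ {a b : ↥(bset D.toDomains)}, a ≠ b → memRel hN D hx₀ hfit hN₁ D₁ a b → ¬ (bondT D).Adj a b →
      a ∈ FaceBlk (m := m) (K := K) hN D t x₀ ∧ b ∈ FaceBlk (m := m) (K := K) hN D t x₀ by
    rcases hrel with h | h
    · exact key hne h hG
    · exact (key hne.symm h (fun h' => hG h'.symm)).symm
  intro a b hne ⟨b₁, b₁', hadj, ha, hb⟩ hG
  obtain ⟨-, z, z', hz, hz', hnorm⟩ := bondT_adj.1 hadj
  obtain ⟨x, hx, hxz⟩ := exists_window_preimage (m := m) (K := K) hN₁ hx₀ hfit z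
  obtain ⟨x', hx', hxz'⟩ := exists_window_preimage (m := m) (K := K) hN₁ hx₀ hfit z'
  have ha' : blkOf D.toDomains (toBox hN x) = a := by
    rw [← ha, ← hz, ← hxz, ψblk_blkOf hN D hx₀ hfit hN₁ D₁ hlevW hal hx]
  have hb' : blkOf D.toDomains (toBox hN x') = b := by
    rw [← hb, ← hz', ← hxz', ψblk_blkOf hN D hx₀ hfit hN₁ D₁ hlevW hal hx']
  -- member labels are global labels minus the corner
  have hlab : ∀ μ, z.1 μ - z'.1 μ = ((x μ).val : ℤ) - ((x' μ).val : ℤ) := fun μ => by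
    rw [← hxz, ← hxz']
    have e1 := congrFun (toBox_eS_eq hN hN₁ hx) μ
    have e2 := congrFun (toBox_eS_eq hN hN₁ hx') μ
    simp only [Pi.sub_apply, toBox_apply] at e1 e2 ⊢
    rw [e1, e2]; ring
  -- the member period in every direction
  have hN₁μ : ∀ μ, (N0 ℓ Mh₁ k₁ P₁ μ : ℤ) = (t.P.sitesPerDir 0 : ℕ) := fun μ => by rw [hN₁ μ]
  -- per coordinate: close or across a face
  have hcoord : ∀ μ, |((x μ).val : ℤ) - (x' μ).val| ≤ 1 ∨
      ((t.P.sitesPerDir 0 : ℕ) : ℤ) - 1 ≤ |((x μ).val : ℤ) - (x' μ).val| := by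
    intro μ
    have h1 : ((circAbs (N0 ℓ Mh₁ k₁ P₁ μ) ((z.1 - z'.1) μ) : ℤ) : ℝ) ≤ 1 :=
      (Finset.le_sup' (fun i => ((circAbs (N0 ℓ Mh₁ k₁ P₁ i) ((z.1 - z'.1) i) : ℤ) : ℝ)) (Finset.mem_univ μ)).trans hnorm
    have h2 : circAbs (N0 ℓ Mh₁ k₁ P₁ μ) ((z.1 - z'.1) μ) ≤ 1 := by exact_mod_cast h1
    rw [Pi.sub_apply, hlab μ] at h2
    have hb1 := (hx μ).1; have hb2 := (hx μ).2; have hb1' := (hx' μ).1; have hb2' := (hx' μ).2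
    simp only [Nat.cast_zero, add_zero] at hb1 hb2 hb1' hb2'
    have hvN : |((x μ).val : ℤ) - (x' μ).val| < (N0 ℓ Mh₁ k₁ P₁ μ : ℕ) := by
      rw [hN₁μ μ, abs_lt]; constructor <;> linarith
    have := abs_cases_of_circAbs_le_one hvN h2
    rwa [hN₁μ μ] at this
  -- not all coordinates are close (else the global blocks touch)
  have hfar : ∃ μ, ((t.P.sitesPerDir 0 : ℕ) : ℤ) - 1 ≤ |((x μ).val : ℤ) - (x' μ).val| := by
    by_contra hall
    push Not at hall
    apply hG
    refine bondT_adj.2 ⟨hne, toBox hN x, toBox hN x', ha', hb', ?_⟩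
    refine (torusSupNorm_le_supNorm (one_le_of_mem (toBox hN x).2) _).trans ?_
    refine Finset.sup'_le _ _ fun μ _ => ?_
    have hμ : |((x μ).val : ℤ) - (x' μ).val| ≤ 1 := by
      rcases hcoord μ with h | h
      · exact h
      · exact absurd h (not_le.2 (hall μ))
    have : |((toBox hN x).1 - (toBox hN x').1) μ| ≤ 1 := by simpa only [Pi.sub_apply, toBox_apply] using hμ
    exact_mod_cast this
  obtain ⟨μ, hμ⟩ := hfar
  have hb1 := (hx μ).1; have hb2 := (hx μ).2; have hb1' := (hx' μ).1; have hb2' := (hx' μ).2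
  simp only [Nat.cast_zero, add_zero] at hb1 hb2 hb1' hb2'
  -- one of the two sites sits on the low face, the other on the high face, in the direction `μ`
  rcases le_or_gt ((x' μ).val : ℤ) ((x μ).val : ℤ) with hle | hlt
  · rw [abs_of_nonneg (by linarith)] at hμ
    exact ⟨⟨x, hx, ha', μ, Or.inr (by linarith)⟩, ⟨x', hx', hb', μ, Or.inl (by linarith)⟩⟩
  · rw [abs_of_neg (by linarith)] at hμ
    exact ⟨⟨x, hx, ha', μ, Or.inl (by linarith)⟩, ⟨x', hx', hb', μ, Or.inr (by linarith)⟩⟩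

/-- **`d′ = d_T` ON PAIRS FAR FROM THE FACES**: if `d_T(y, y′) ≤ d_T(y, a) + 1` for every face block `a`, the glued distance of `(y, y′)` is the
global one (a glued geodesic using a wrap bond first reaches a face block) — the located pairs of (2.134) (`y, y′` in the core of the window).
[cite: Balaban1984PropagatorsII, (2.134) p.247 («y, y′ ∈ 𝔅 ∩ T_□»), (2.46) p.231; derivation ours] -/
theorem dist_eq_of_far_faces (hlevW : ∀ x ∈ DeepS t x₀ 0, D₁.lev (toBox hN₁ (eS t x₀ x) : Fin (d + 1) → ℤ) = D.lev (toBox hN x))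
    (hal : ∀ μ, (((ℓ + 1) ^ k₁ : ℕ) : ℤ) ∣ x₀ μ) (hMh : 1 ≤ Mh) (hP : ∀ μ, 1 ≤ P' μ) {y y' : ↥(bset D.toDomains)}
    (hfar : ∀ a ∈ FaceBlk (m := m) (K := K) hN D t x₀, (geomTB D).dist y y' ≤ (geomTB D).dist y a + 1) :
    (geomW hN D hx₀ hfit hN₁ D₁).dist y y' = (geomTB D).dist y y' := by
  refine le_antisymm (distW_le_distT hN D hx₀ hfit hN₁ D₁ hMh hP y y') ?_
  rw [geomW_dist]
  show (((bondT D).dist y y' : ℕ) : ℝ) ≤ _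
  rcases dist_sup_cases (H := SimpleGraph.fromRel (memRel hN D hx₀ hfit hN₁ D₁)) (connectedT (D := D) hMh hP) y y' with h | ⟨a, b, hab, hnab, h⟩
  · exact_mod_cast h.le
  · have ha := (foreign_face hN D hx₀ hfit hN₁ D₁ hlevW hal hab hnab).1
    have h1 : (((bondT D).dist y y' : ℕ) : ℝ) ≤ (((bondT D).dist y a : ℕ) : ℝ) + 1 := hfar a ha
    have h2 : (bondT D).dist y y' ≤ (bondT D).dist y a + 1 := by exact_mod_cast h1
    exact_mod_cast (show (bondT D).dist y y' ≤ (gluedBond hN D hx₀ hfit hN₁ D₁).dist y y' by unfold gluedBond; omega)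

/-- **`d′` IS AT LEAST `min(d_T(y,y′), d_T(y, faces))`** (real form): a glued geodesic either stays in the torus graph or passes a face block first —
the lower bound the depth `M₀` of the line-3 cut-offs to the zone is read from. [cite: Balaban1984PropagatorsII, (2.46) p.231, p.238 (□̃ margins); derivation ours] -/
theorem le_distW_of_far (hlevW : ∀ x ∈ DeepS t x₀ 0, D₁.lev (toBox hN₁ (eS t x₀ x) : Fin (d + 1) → ℤ) = D.lev (toBox hN x))
    (hal : ∀ μ, (((ℓ + 1) ^ k₁ : ℕ) : ℤ) ∣ x₀ μ) (hMh : 1 ≤ Mh) (hP : ∀ μ, 1 ≤ P' μ) {y y' : ↥(bset D.toDomains)} {r : ℝ}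
    (h1 : r ≤ (geomTB D).dist y y') (h2 : ∀ a ∈ FaceBlk (m := m) (K := K) hN D t x₀, r ≤ (geomTB D).dist y a + 1) :
    r ≤ (geomW hN D hx₀ hfit hN₁ D₁).dist y y' := by
  rw [geomW_dist]
  rcases dist_sup_cases (H := SimpleGraph.fromRel (memRel hN D hx₀ hfit hN₁ D₁)) (connectedT (D := D) hMh hP) y y' with h | ⟨a, b, hab, hnab, h⟩
  · have e : (gluedBond hN D hx₀ hfit hN₁ D₁).dist y y' = (bondT D).dist y y' := by unfold gluedBond; exact h.symm
    rw [e]; exact h1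
  · have ha := (foreign_face hN D hx₀ hfit hN₁ D₁ hlevW hal hab hnab).1
    have h3 : (bondT D).dist y a + 1 ≤ (gluedBond hN D hx₀ hfit hN₁ D₁).dist y y' := by unfold gluedBond; omega
    have h4 : (((bondT D).dist y a : ℕ) : ℝ) + 1 ≤ (((gluedBond hN D hx₀ hfit hN₁ D₁).dist y y' : ℕ) : ℝ) := by exact_mod_cast h3
    exact (h2 a ha).trans h4

end Faces

/-! ## §5  Level separation, the (2.60)-type transfer and the (2.61)-type profile for `d′` -/

section Transfer

variable {d ℓ : ℕ} {m K : ℕ} {hd : 1 ≤ d + 1} {hL : Odd (ℓ + 1) ∧ 1 < ℓ + 1} {Mh k R : ℕ} {P' : Fin (d + 1) → ℕ}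
variable (hN : ∀ μ, N0 ℓ Mh k P' μ = (PV d ℓ m K hd hL).sitesPerDir 0) (D : TDomains d ℓ Mh k P' R)
variable {a₀ a₁ : ℝ} {t : TSIdx d (ℓ + 1) hd hL a₀ a₁} {x₀ : Fin (d + 1) → ℤ}
variable (hx₀ : ∀ μ, 0 ≤ x₀ μ) (hfit : ∀ μ, x₀ μ + (t.P.sitesPerDir 0 : ℕ) ≤ ((PV d ℓ m K hd hL).sitesPerDir 0 : ℕ))
variable {Mh₁ k₁ R₁ : ℕ} {P₁ : Fin (d + 1) → ℕ}
variable (hN₁ : ∀ μ, N0 ℓ Mh₁ k₁ P₁ μ = (PV d ℓ t.m t.K hd hL).sitesPerDir 0) (D₁ : TDomains d ℓ Mh₁ k₁ P₁ R₁)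

/-- endpoints of transported member bonds have levels in `[jlo, k₁]` when the member's levels do. [cite: Balaban1984PropagatorsII, (2.89) p.239 («sequence Ω_j, Ω_{j+1}»), dictionary] -/
theorem level_of_memRel (hlevW : ∀ x ∈ DeepS t x₀ 0, D₁.lev (toBox hN₁ (eS t x₀ x) : Fin (d + 1) → ℤ) = D.lev (toBox hN x))
    {jlo : ℕ} (hlo : ∀ z : ↥(boxDom (N0 ℓ Mh₁ k₁ P₁)), jlo ≤ D₁.lev z.1) {a b : ↥(bset D.toDomains)}
    (h : (SimpleGraph.fromRel (memRel hN D hx₀ hfit hN₁ D₁)).Adj a b) : jlo ≤ a.1.1 ∧ a.1.1 ≤ k₁ := by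
  obtain ⟨-, hrel⟩ := (SimpleGraph.fromRel_adj _ _ _).1 h
  have key : ∀ b₁ : ↥(bset D₁.toDomains), jlo ≤ (ψblk hN D hx₀ hfit hN₁ D₁ b₁).1.1 ∧ (ψblk hN D hx₀ hfit hN₁ D₁ b₁).1.1 ≤ k₁ := by
    intro b₁
    rw [ψblk_level hN D hx₀ hfit hN₁ D₁ hlevW]
    obtain ⟨z, rfl⟩ := exists_blkOf_eq D₁.toDomains b₁
    exact ⟨hlo z, D₁.lev_le _⟩
  rcases hrel with ⟨b₁, b₁', -, rfl, -⟩ | ⟨b₁, b₁', -, -, rfl⟩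
  · exact key b₁
  · exact key b₁'

/-- **LEVEL SEPARATION FOR `d′`**: `R·M·(|j(y) − j(y′)| − (2 + (k₁ − jlo))) ≤ d′(y, y′)` — the global (2.60) (`levelSepTB`: `R·M·(|Δj| − 1) ≤ d_T`)
on the global segments before the first and after the last wrap bond of a glued geodesic, the member's level spread in between.
[cite: Balaban1984PropagatorsII, (2.60) p.234, (2.2) p.224; derivation ours] -/
theorem levelSepW (hlevW : ∀ x ∈ DeepS t x₀ 0, D₁.lev (toBox hN₁ (eS t x₀ x) : Fin (d + 1) → ℤ) = D.lev (toBox hN x))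
    {jlo : ℕ} (hlo : ∀ z : ↥(boxDom (N0 ℓ Mh₁ k₁ P₁)), jlo ≤ D₁.lev z.1) (hjlo : jlo ≤ k₁) (hMh : 1 ≤ Mh) (hP : ∀ μ, 1 ≤ P' μ)
    (hRM : 1 ≤ R * ((ℓ + 1) * Mh)) (y y' : ↥(bset D.toDomains)) :
    (geomTB D).R * (geomTB D).M * (|(y.1.1 : ℝ) - y'.1.1| - (2 + ((k₁ : ℝ) - jlo))) ≤ (geomW hN D hx₀ hfit hN₁ D₁).dist y y' := by
  have hsep := levelSepTB D hMh hP hRM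
  have hRM0 : 0 ≤ (geomTB D).R * (geomTB D).M := B8Ineq192MultiLevelTorus.geomTB_RM_nonneg D hMh hRM
  -- the global (2.60) in the form `RM·(|Δj| − 1) ≤ d_T`
  have hglob : ∀ u v : ↥(bset D.toDomains),
      (geomTB D).R * (geomTB D).M * (|(u.1.1 : ℝ) - v.1.1| - 1) ≤ (((bondT D).dist u v : ℕ) : ℝ) := by
    intro u v
    have h := hsep u v
    have hmx : |(u.1.1 : ℝ) - v.1.1| - 1 ≤ mx (geomTB D) u v := le_max_left _ _
    exact (mul_le_mul_of_nonneg_left hmx hRM0).trans h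
  -- levels of wrap-bond endpoints
  have hwin : ∀ {a b : ↥(bset D.toDomains)}, (SimpleGraph.fromRel (memRel hN D hx₀ hfit hN₁ D₁)).Adj a b →
      (jlo : ℝ) ≤ a.1.1 ∧ (a.1.1 : ℝ) ≤ k₁ := fun h => by
    have := level_of_memRel hN D hx₀ hfit hN₁ D₁ hlevW hlo h
    exact ⟨by exact_mod_cast this.1, by exact_mod_cast this.2⟩
  have hconn := connectedT (D := D) hMh hP
  rw [geomW_dist]
  unfold gluedBond
  set H := SimpleGraph.fromRel (memRel hN D hx₀ hfit hN₁ D₁) with hH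
  rcases dist_sup_cases (H := H) hconn y y' with h0 | ⟨a, b, hab, -, h1⟩
  · -- no wrap bond: the global separation
    have := hglob y y'
    rw [h0] at this
    have hk : (0 : ℝ) ≤ (k₁ : ℝ) - jlo := sub_nonneg.2 (by exact_mod_cast hjlo)
    have key : (geomTB D).R * (geomTB D).M * (|(y.1.1 : ℝ) - y'.1.1| - (2 + ((k₁ : ℝ) - jlo))) ≤
        (geomTB D).R * (geomTB D).M * (|(y.1.1 : ℝ) - y'.1.1| - 1) := mul_le_mul_of_nonneg_left (by linarith) hRM0
    linarith
  · -- first wrap bond `(a, b)`; then the last one on the remaining geodesic from `b`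
    have hya := hglob y a
    obtain ⟨hja1, hja2⟩ := hwin hab
    rcases dist_sup_cases' (H := H) hconn b y' with h2 | ⟨a', b', hab', -, h3⟩
    · obtain ⟨hjb1, hjb2⟩ := hwin hab.symm
      have hby := hglob b y'
      have htri : |(y.1.1 : ℝ) - y'.1.1| ≤ |(y.1.1 : ℝ) - a.1.1| + |(a.1.1 : ℝ) - b.1.1| + |(b.1.1 : ℝ) - y'.1.1| := by
        have := abs_sub_le (y.1.1 : ℝ) a.1.1 y'.1.1
        have := abs_sub_le (a.1.1 : ℝ) b.1.1 y'.1.1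
        linarith
      have hab2 : |(a.1.1 : ℝ) - b.1.1| ≤ (k₁ : ℝ) - jlo := abs_sub_le_iff.2 ⟨by linarith [hja2, hjb1], by linarith [hjb2, hja1]⟩
      have hsum : (((bondT D).dist y a : ℕ) : ℝ) + (((bondT D).dist b y' : ℕ) : ℝ) ≤ (((bondT D ⊔ H).dist y y' : ℕ) : ℝ) := by
        exact_mod_cast (show (bondT D).dist y a + (bondT D).dist b y' ≤ (bondT D ⊔ H).dist y y' by omega)
      have key : (geomTB D).R * (geomTB D).M * (|(y.1.1 : ℝ) - y'.1.1| - (2 + ((k₁ : ℝ) - jlo))) ≤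
          (geomTB D).R * (geomTB D).M * (|(y.1.1 : ℝ) - a.1.1| - 1) + (geomTB D).R * (geomTB D).M * (|(b.1.1 : ℝ) - y'.1.1| - 1) := by
        rw [← mul_add]
        exact mul_le_mul_of_nonneg_left (by linarith) hRM0
      linarith
    · obtain ⟨hjb1, hjb2⟩ := hwin hab'.symm
      have hby := hglob b' y'
      have htri : |(y.1.1 : ℝ) - y'.1.1| ≤ |(y.1.1 : ℝ) - a.1.1| + |(a.1.1 : ℝ) - b'.1.1| + |(b'.1.1 : ℝ) - y'.1.1| := by
        have := abs_sub_le (y.1.1 : ℝ) a.1.1 y'.1.1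
        have := abs_sub_le (a.1.1 : ℝ) b'.1.1 y'.1.1
        linarith
      have hab2 : |(a.1.1 : ℝ) - b'.1.1| ≤ (k₁ : ℝ) - jlo := abs_sub_le_iff.2 ⟨by linarith [hja2, hjb1], by linarith [hjb2, hja1]⟩
      have hsum : (((bondT D).dist y a : ℕ) : ℝ) + (((bondT D).dist b' y' : ℕ) : ℝ) ≤ (((bondT D ⊔ H).dist y y' : ℕ) : ℝ) := by
        exact_mod_cast (show (bondT D).dist y a + (bondT D).dist b' y' ≤ (bondT D ⊔ H).dist y y' by omega)
      have key : (geomTB D).R * (geomTB D).M * (|(y.1.1 : ℝ) - y'.1.1| - (2 + ((k₁ : ℝ) - jlo))) ≤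
          (geomTB D).R * (geomTB D).M * (|(y.1.1 : ℝ) - a.1.1| - 1) + (geomTB D).R * (geomTB D).M * (|(b'.1.1 : ℝ) - y'.1.1| - 1) := by
        rw [← mul_add]
        exact mul_le_mul_of_nonneg_left (by linarith) hRM0
      linarith

/-- **THE (2.60)-TYPE TRANSFER FOR `d′`** in p38's form `e^{−κd′(y,y′)}·w(y′) ≤ Λ·w(y)` with the block weights `w = Lʲ·w₀` (`w₀ > 0` any
common unit, e.g. `1/c′`): `Λ = L^{2 + spread}` as soon as `κ·R·M ≥ log L`. [cite: Balaban1984PropagatorsII, (2.60) p.234; derivation ours] -/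
theorem transferW (hlevW : ∀ x ∈ DeepS t x₀ 0, D₁.lev (toBox hN₁ (eS t x₀ x) : Fin (d + 1) → ℤ) = D.lev (toBox hN x))
    {jlo : ℕ} (hlo : ∀ z : ↥(boxDom (N0 ℓ Mh₁ k₁ P₁)), jlo ≤ D₁.lev z.1) (hjlo : jlo ≤ k₁) (hMh : 1 ≤ Mh) (hP : ∀ μ, 1 ≤ P' μ)
    (hRM : 1 ≤ R * ((ℓ + 1) * Mh)) {κ : ℝ} (hκ : 0 ≤ κ) (hκRM : Real.log ((ℓ : ℝ) + 1) ≤ κ * ((geomTB D).R * (geomTB D).M))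
    {w₀ : ℝ} (hw₀ : 0 ≤ w₀) (y y' : ↥(bset D.toDomains)) :
    Real.exp (-(κ * (geomW hN D hx₀ hfit hN₁ D₁).dist y y')) * (((ℓ : ℝ) + 1) ^ y'.1.1 * w₀) ≤
      ((ℓ : ℝ) + 1) ^ (2 + (k₁ - jlo)) * (((ℓ : ℝ) + 1) ^ y.1.1 * w₀) := by
  have hL1 : (1 : ℝ) < (ℓ : ℝ) + 1 := by exact_mod_cast hL.2
  have hL0 : (0 : ℝ) < (ℓ : ℝ) + 1 := by linarith
  have hsep := levelSepW hN D hx₀ hfit hN₁ D₁ hlevW hlo hjlo hMh hP hRM y y'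
  set dd := (geomW hN D hx₀ hfit hN₁ D₁).dist y y' with hdd
  set N := (geomTB D).R * (geomTB D).M with hNdef
  have hN0 : 0 ≤ N := B8Ineq192MultiLevelTorus.geomTB_RM_nonneg D hMh hRM
  -- `L^{j′} ≤ L^{j + |j − j′|}` and `|j − j′| ≤ 2 + spread + d′/N`-type bound through `log L ≤ κN`
  have hsp : ((k₁ - jlo : ℕ) : ℝ) = (k₁ : ℝ) - jlo := by rw [Nat.cast_sub hjlo]
  -- exponent comparison: (j′ − j − (2 + spread))·log L ≤ κ·d′
  have hexp : ((y'.1.1 : ℝ) - y.1.1 - (2 + ((k₁ : ℝ) - jlo))) * Real.log ((ℓ : ℝ) + 1) ≤ κ * dd := by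
    have h1 : (y'.1.1 : ℝ) - y.1.1 ≤ |(y.1.1 : ℝ) - y'.1.1| := by rw [abs_sub_comm]; exact le_abs_self _
    by_cases hc : (y'.1.1 : ℝ) - y.1.1 - (2 + ((k₁ : ℝ) - jlo)) ≤ 0
    · have : ((y'.1.1 : ℝ) - y.1.1 - (2 + ((k₁ : ℝ) - jlo))) * Real.log ((ℓ : ℝ) + 1) ≤ 0 :=
        mul_nonpos_of_nonpos_of_nonneg hc (Real.log_nonneg hL1.le)
      have : 0 ≤ κ * dd := mul_nonneg hκ (distW_nonneg hN D hx₀ hfit hN₁ D₁ y y')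
      linarith
    · push Not at hc
      calc ((y'.1.1 : ℝ) - y.1.1 - (2 + ((k₁ : ℝ) - jlo))) * Real.log ((ℓ : ℝ) + 1)
          ≤ ((y'.1.1 : ℝ) - y.1.1 - (2 + ((k₁ : ℝ) - jlo))) * (κ * N) := mul_le_mul_of_nonneg_left hκRM hc.le
        _ = κ * (N * ((y'.1.1 : ℝ) - y.1.1 - (2 + ((k₁ : ℝ) - jlo)))) := by ring
        _ ≤ κ * (N * (|(y.1.1 : ℝ) - y'.1.1| - (2 + ((k₁ : ℝ) - jlo)))) := by gcongr
        _ ≤ κ * dd := mul_le_mul_of_nonneg_left hsep hκ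
  -- assemble with `exp`/`log`
  have key : Real.exp (-(κ * dd)) * ((ℓ : ℝ) + 1) ^ y'.1.1 ≤ ((ℓ : ℝ) + 1) ^ (2 + (k₁ - jlo)) * ((ℓ : ℝ) + 1) ^ y.1.1 := by
    rw [← Real.rpow_natCast, ← Real.rpow_natCast, ← Real.rpow_natCast, ← Real.rpow_add hL0, Real.rpow_def_of_pos hL0,
      Real.rpow_def_of_pos hL0, ← Real.exp_add]
    apply Real.exp_le_exp.2
    push_cast
    rw [hsp]
    nlinarith [hexp, Real.log_nonneg hL1.le]
  calc Real.exp (-(κ * dd)) * (((ℓ : ℝ) + 1) ^ y'.1.1 * w₀) = (Real.exp (-(κ * dd)) * ((ℓ : ℝ) + 1) ^ y'.1.1) * w₀ := by ring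
    _ ≤ (((ℓ : ℝ) + 1) ^ (2 + (k₁ - jlo)) * ((ℓ : ℝ) + 1) ^ y.1.1) * w₀ := mul_le_mul_of_nonneg_right key hw₀
    _ = _ := by ring

/-- **THE (2.61)-TYPE PROFILE FOR `d′`**: `Σ_b e^{−a d′(y,b)} ≤ K(a)·(1 + #𝔅(T_□))` from the global profile `Σ_b e^{−a d_T(y,b)} ≤ K(a)` (a glued
geodesic is global after its last wrap bond, whose head is one of the `#𝔅(T_□)` window blocks). [cite: Balaban1984PropagatorsII, (2.61) p.234; derivation ours] -/
theorem profileW (hMh : 1 ≤ Mh) (hP : ∀ μ, 1 ≤ P' μ) {Kp : ℝ → ℝ} (hK : Profile (geomTB D).dist (fun a : ↥(bset D.toDomains) => a) Kp) :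
    Profile (geomW hN D hx₀ hfit hN₁ D₁).dist (fun a : ↥(bset D.toDomains) => a)
      (fun a => Kp a * (1 + Fintype.card ↥(bset D₁.toDomains))) := by
  classical
  intro a ha s
  have hconn := connectedT (D := D) hMh hP
  set H := SimpleGraph.fromRel (memRel hN D hx₀ hfit hN₁ D₁) with hH
  -- pointwise: e^{−a d′(s,b)} ≤ e^{−a d_T(s,b)} + Σ_{b₁} e^{−a d_T(ψ b₁, b)}
  have hpt : ∀ b : ↥(bset D.toDomains), Real.exp (-(a * (geomW hN D hx₀ hfit hN₁ D₁).dist s b)) ≤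
      Real.exp (-(a * (geomTB D).dist s b)) +
        ∑ b₁ : ↥(bset D₁.toDomains), Real.exp (-(a * (geomTB D).dist (ψblk hN D hx₀ hfit hN₁ D₁ b₁) b)) := by
    intro b
    have hnn : 0 ≤ ∑ b₁ : ↥(bset D₁.toDomains), Real.exp (-(a * (geomTB D).dist (ψblk hN D hx₀ hfit hN₁ D₁ b₁) b)) :=
      Finset.sum_nonneg fun _ _ => (Real.exp_pos _).le
    rw [geomW_dist]
    rcases dist_sup_cases' (H := H) hconn s b with h0 | ⟨a', b', hab', -, h1⟩
    · have : (geomTB D).dist s b = (((bondT D).dist s b : ℕ) : ℝ) := rfl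
      rw [this, h0]
      unfold gluedBond
      linarith
    · -- the head `b′` of the last wrap bond is `ψ b₁` for some member block
      obtain ⟨-, hrel⟩ := (SimpleGraph.fromRel_adj _ _ _).1 hab'
      obtain ⟨b₁, hb₁⟩ : ∃ b₁, ψblk hN D hx₀ hfit hN₁ D₁ b₁ = b' := by
        rcases hrel with ⟨_, b₁', _, _, h⟩ | ⟨b₁, _, _, h, _⟩
        · exact ⟨b₁', h⟩
        · exact ⟨b₁, h⟩
      have hle : (geomTB D).dist (ψblk hN D hx₀ hfit hN₁ D₁ b₁) b ≤ (((bondT D ⊔ H).dist s b : ℕ) : ℝ) := by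
        rw [hb₁]
        show (((bondT D).dist b' b : ℕ) : ℝ) ≤ _
        exact_mod_cast (show (bondT D).dist b' b ≤ (bondT D ⊔ H).dist s b by omega)
      have hterm : Real.exp (-(a * (((bondT D ⊔ H).dist s b : ℕ) : ℝ))) ≤
          Real.exp (-(a * (geomTB D).dist (ψblk hN D hx₀ hfit hN₁ D₁ b₁) b)) :=
        Real.exp_le_exp.2 (by nlinarith)
      have hsingle : Real.exp (-(a * (geomTB D).dist (ψblk hN D hx₀ hfit hN₁ D₁ b₁) b)) ≤
          ∑ b₁ : ↥(bset D₁.toDomains), Real.exp (-(a * (geomTB D).dist (ψblk hN D hx₀ hfit hN₁ D₁ b₁) b)) :=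
        Finset.single_le_sum (f := fun b₂ => Real.exp (-(a * (geomTB D).dist (ψblk hN D hx₀ hfit hN₁ D₁ b₂) b)))
          (fun _ _ => (Real.exp_pos _).le) (Finset.mem_univ b₁)
      unfold gluedBond
      linarith [(Real.exp_pos (-(a * (geomTB D).dist s b))).le]
  calc ∑ b, Real.exp (-(a * (geomW hN D hx₀ hfit hN₁ D₁).dist s b))
      ≤ ∑ b, (Real.exp (-(a * (geomTB D).dist s b)) +
          ∑ b₁ : ↥(bset D₁.toDomains), Real.exp (-(a * (geomTB D).dist (ψblk hN D hx₀ hfit hN₁ D₁ b₁) b))) :=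
        Finset.sum_le_sum fun b _ => hpt b
    _ = ∑ b, Real.exp (-(a * (geomTB D).dist s b)) +
          ∑ b₁ : ↥(bset D₁.toDomains), ∑ b, Real.exp (-(a * (geomTB D).dist (ψblk hN D hx₀ hfit hN₁ D₁ b₁) b)) := by
        rw [Finset.sum_add_distrib, Finset.sum_comm]
    _ ≤ Kp a + ∑ _b₁ : ↥(bset D₁.toDomains), Kp a := add_le_add (hK a ha s) (Finset.sum_le_sum fun b₁ _ => hK a ha _)
    _ = Kp a * (1 + Fintype.card ↥(bset D₁.toDomains)) := by
        rw [Finset.sum_const, Finset.card_univ, nsmul_eq_mul]; ring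

end Transfer

/-! ## §6  Transport of member majorants through the window; global majorants under `d′ ≤ d_T` -/

section Transport

variable {d ℓ : ℕ} {m K : ℕ} {hd : 1 ≤ d + 1} {hL : Odd (ℓ + 1) ∧ 1 < ℓ + 1} {Mh k R : ℕ} {P' : Fin (d + 1) → ℕ}
variable (hN : ∀ μ, N0 ℓ Mh k P' μ = (PV d ℓ m K hd hL).sitesPerDir 0) (D : TDomains d ℓ Mh k P' R)
variable {a₀ a₁ : ℝ} {t : TSIdx d (ℓ + 1) hd hL a₀ a₁} {x₀ : Fin (d + 1) → ℤ}
variable (hx₀ : ∀ μ, 0 ≤ x₀ μ) (hfit : ∀ μ, x₀ μ + (t.P.sitesPerDir 0 : ℕ) ≤ ((PV d ℓ m K hd hL).sitesPerDir 0 : ℕ))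
variable {Mh₁ k₁ R₁ : ℕ} {P₁ : Fin (d + 1) → ℕ}
variable (hN₁ : ∀ μ, N0 ℓ Mh₁ k₁ P₁ μ = (PV d ℓ t.m t.K hd hL).sitesPerDir 0) (D₁ : TDomains d ℓ Mh₁ k₁ P₁ R₁)

/-- **A GLOBAL MAJORANT IS A `d′`-MAJORANT** (`d′ ≤ d_T`, kernels `φ·e^{−δd}` decreasing in `d`). [cite: Balaban1984PropagatorsII, (2.67) p.234, (2.46) p.231; derivation ours] -/
theorem hasMajorant_glob_W (hMh : 1 ≤ Mh) (hP : ∀ μ, 1 ≤ P' μ) {X : Type} (bl : X → ↥(bset D.toDomains)) {T : Module.End ℝ (X → ℝ)}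
    {φ : ↥(bset D.toDomains) → ℝ} (hφ : ∀ a, 0 ≤ φ a) {δ : ℝ} (hδ : 0 ≤ δ)
    (h : HasMajorant (g := geomTB D) bl T (fun a b => φ a * Real.exp (-(δ * (geomTB D).dist a b)))) :
    HasMajorant (g := geomW hN D hx₀ hfit hN₁ D₁) bl T (fun a b => φ a * Real.exp (-(δ * (geomW hN D hx₀ hfit hN₁ D₁).dist a b))) := by
  intro y' μ B hμ x
  refine (h y' μ B ⟨hμ.nonneg, hμ.bound, hμ.off⟩ x).trans (mul_le_mul_of_nonneg_right ?_ hμ.nonneg)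
  exact mul_le_mul_of_nonneg_left (Real.exp_le_exp.2 (by
    have := distW_le_distT hN D hx₀ hfit hN₁ D₁ hMh hP (bl x) y'; nlinarith)) (hφ _)

/-- **TRANSPORT OF A MEMBER MAJORANT THROUGH THE WINDOW** (generic kernels): if `T′` on `T_□` has the majorant `K′` w.r.t. the member's blocks and
`K′(blkOf(e x), blkOf(e x₁)) ≤ K(blkOf x, blkOf x₁)` on window sites, then `εT′ρ` has the majorant `K` on `T_η` for ALL block pairs (rows off the
window vanish; a global block meeting the window is ONE member block). [cite: Balaban1984PropagatorsII, (2.133) p.247, p.238 (T_□); derivation ours] -/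
theorem hasMajorant_transplant_window
    (hlevW : ∀ x ∈ DeepS t x₀ 0, D₁.lev (toBox hN₁ (eS t x₀ x) : Fin (d + 1) → ℤ) = D.lev (toBox hN x))
    (hal : ∀ μ, (((ℓ + 1) ^ k₁ : ℕ) : ℤ) ∣ x₀ μ) {T' : Module.End ℝ (Site t.P 0 → ℝ)}
    {K' : ↥(bset D₁.toDomains) → ↥(bset D₁.toDomains) → ℝ} (hT' : HasMajorant (g := geomTB D₁) (blkS hN₁ D₁) T' K')
    (Kf : ↥(bset D.toDomains) → ↥(bset D.toDomains) → ℝ) (hK : ∀ a b, 0 ≤ Kf a b)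
    (hcomp : ∀ x ∈ DeepS t x₀ 0, ∀ x₁ ∈ DeepS t x₀ 0,
      K' (blkS hN₁ D₁ (eS t x₀ x)) (blkS hN₁ D₁ (eS t x₀ x₁)) ≤ Kf (blkS hN D x) (blkS hN D x₁)) :
    HasMajorant (g := geomW hN D hx₀ hfit hN₁ D₁) (blkS hN D) (transplant (cS t x₀ hx₀ hfit).W (eS t x₀) T') Kf := by
  classical
  have hinj := (cS t x₀ hx₀ hfit).inj
  simp only [cS_e] at hinj
  have hloc := localMajorant_transplant (g := geomW hN D hx₀ hfit hN₁ D₁) (g' := geomTB D₁) (W := (cS t x₀ hx₀ hfit).W) (e := eS t x₀)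
    (blkS hN D) (blkS hN₁ D₁) Set.univ hinj hT' Kf hK
    (fun x hx x₁ hx₁ _ _ => hcomp x (mem_cS_W.1 hx) x₁ (mem_cS_W.1 hx₁)) 1 (fun y _ => ?_)
  · intro y' μ B hμ x
    have := hloc y' (Set.mem_univ _) μ B hμ x (Set.mem_univ _)
    simpa only [Nat.cast_one, one_mul] using this
  · -- the fibre of a global block in the member's blocks has at most one element
    by_cases hy : ∃ xs ∈ (cS t x₀ hx₀ hfit).W, blkS hN D xs = y
    · obtain ⟨xs, hxs, hys⟩ := hy
      refine ⟨{blkS hN₁ D₁ (eS t x₀ xs)}, le_of_eq (Finset.card_singleton _), fun x hx hxy => ?_⟩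
      exact Finset.mem_singleton.2
        ((blkOf_eS_eq_iff hN D hN₁ D₁ hlevW hal (mem_cS_W.1 hx) (mem_cS_W.1 hxs)).2 (hxy.trans hys.symm))
    · exact ⟨∅, Finset.card_empty.trans_le zero_le_one, fun x hx hxy => absurd ⟨x, hx, hxy⟩ hy⟩

/-- **TRANSPORT OF THE (2.67)/(2.87)-SHAPE MAJORANTS**: a member majorant `φ(j(b))·e^{−δd_{T_□}(b,b′)}` (level-dependent prefactor: `B₁(Lʲ/c)²`,
`B_S(Lʲ/c)^{−4}`, …) of `T′` becomes the majorant `φ(j(y))·e^{−δd′(y,y′)}` of `εT′ρ` on the glued geometry, for all block pairs.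
[cite: Balaban1984PropagatorsII, (2.67) p.234, (2.87) p.238, p.238–239 (T_□); derivation ours] -/
theorem hasMajorant_member_W
    (hlevW : ∀ x ∈ DeepS t x₀ 0, D₁.lev (toBox hN₁ (eS t x₀ x) : Fin (d + 1) → ℤ) = D.lev (toBox hN x))
    (hal : ∀ μ, (((ℓ + 1) ^ k₁ : ℕ) : ℤ) ∣ x₀ μ) (hMh₁ : 1 ≤ Mh₁) (hP₁ : ∀ μ, 1 ≤ P₁ μ) {T' : Module.End ℝ (Site t.P 0 → ℝ)}
    {φ : ℕ → ℝ} (hφ : ∀ j, 0 ≤ φ j) {δ : ℝ} (hδ : 0 ≤ δ)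
    (hT' : HasMajorant (g := geomTB D₁) (blkS hN₁ D₁) T' (fun b b' => φ b.1.1 * Real.exp (-(δ * (geomTB D₁).dist b b')))) :
    HasMajorant (g := geomW hN D hx₀ hfit hN₁ D₁) (blkS hN D) (transplant (cS t x₀ hx₀ hfit).W (eS t x₀) T')
      (fun y y' => φ y.1.1 * Real.exp (-(δ * (geomW hN D hx₀ hfit hN₁ D₁).dist y y'))) := by
  refine hasMajorant_transplant_window hN D hx₀ hfit hN₁ D₁ hlevW hal hT' _
    (fun a b => mul_nonneg (hφ _) (Real.exp_pos _).le) fun x hx x₁ hx₁ => ?_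
  -- levels agree; distances compare through `ψ`
  have hl : (blkS hN₁ D₁ (eS t x₀ x)).1.1 = (blkS hN D x).1.1 := by
    show D₁.toDomains.lev _ = D.toDomains.lev _
    simp only [TDomains.toDomains_lev]
    exact hlevW x hx
  have hψ := ψblk_blkOf hN D hx₀ hfit hN₁ D₁ hlevW hal hx
  have hψ₁ := ψblk_blkOf hN D hx₀ hfit hN₁ D₁ hlevW hal hx₁
  have hd : (geomW hN D hx₀ hfit hN₁ D₁).dist (blkS hN D x) (blkS hN D x₁) ≤
      (geomTB D₁).dist (blkS hN₁ D₁ (eS t x₀ x)) (blkS hN₁ D₁ (eS t x₀ x₁)) := by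
    have := distW_ψ_le hN D hx₀ hfit hN₁ D₁ hlevW hal hMh₁ hP₁ (blkS hN₁ D₁ (eS t x₀ x)) (blkS hN₁ D₁ (eS t x₀ x₁))
    rwa [show ψblk hN D hx₀ hfit hN₁ D₁ (blkS hN₁ D₁ (eS t x₀ x)) = blkS hN D x from hψ,
      show ψblk hN D hx₀ hfit hN₁ D₁ (blkS hN₁ D₁ (eS t x₀ x₁)) = blkS hN D x₁ from hψ₁] at this
  rw [hl]
  exact mul_le_mul_of_nonneg_left (Real.exp_le_exp.2 (by nlinarith)) (hφ _)

end Transport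

end Literature.MathematicalPhysics.QuantumFieldTheory.Balaban1983to89.B6GluedDistWindow
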